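import Summits.SmoothPoincare4.SmoothPoincare4.Theses.EntropyRung
import Summits.SmoothPoincare4.SmoothPoincare4.Theorems.EntropyRungSubcylindricalExistenceCapClauseEuclideanSchwarzschildAux
import Summits.SmoothPoincare4.SmoothPoincare4.Theorems.EntropyRungSubcylindricalExistenceCapClauseEuclideanSchwarzschildAlgAux
import Summits.SmoothPoincare4.SmoothPoincare4.Theorems.EntropyRungSubcylindricalExistenceSphereSideClause
import Mathlib.Analysis.Calculus.Gradient.Basic
import HarnessLib

/-!
# The perturbative cap clause on `ℝ⁴` in the Schwarzschild gauge (stub E2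
# `stub_capClauseEuclideanSchwarzschild`, line `green-blowup-conformal-entropy`, reshape R-c3,
# crux `EntropyRung.SubcylindricalExistence`, item stmt-SmoothPoincare4-10871)

In the flat chart at the blow-up point the Green function with mass is `G = a/‖z‖² + b` (`a > 0`,
`b ≥ 0`), the cap factor is `Ψ = 4KG/(4K+G) = 4K(a+bm)/((4K+b)m+a)` (`m = ‖z‖²`) and its curvature
weight is `r = 12a²/(K(a+bm)³)`. We prove Perelman's `𝒲`-clause of `Ψ²δ` at level
`log 6 − 2 − 100θ`, uniformly in the scale `τ > 0` and in `K`, for smooth `v` supported in the ball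
of radius `ρ₁`, whenever `bρ₁² ≤ θa`, `b ≤ θK`, `θ ≤ 1/100`.

Proof. `Ψ = u ψ₀` with the ROUND bubble `ψ₀ = C/(m+E)` (`E = a/(4K+b)`, `μ = (4K+b)/(4K)`,
`C = a/μ²`) and the explicit quadratic `u = μ(1 + (b/a)m)`, `1 ≤ u ≤ u_max = 1 + O(θ)` on the
support. Substitute `w = u²v`: the normalisation is preserved (`v²Ψ⁴ = w²ψ₀⁴`), the entropy term
only improves (`log w² ≥ log v²`), the curvature weights compare (`r ≥ u_max⁻³ r₀`,
`r₀ = 48E/C² = 12/R²` the round weight), and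
`Ψ²‖∇v‖² = ψ₀²u⁻²‖∇w − 2uv∇u‖² ≥ (1−t)u_max⁻²ψ₀²‖∇w‖² − (1/t−1)·16μ²β²·mψ₀²w²` (Cauchy–Schwarz,
`t = 5θ`); the potential `mψ₀²w² ≤ (ρ₁²+E)²·C²m/(m+E)⁴·w²` is absorbed by the Hardy identity
`∫ C²(m−4E)/(m+E)⁴w² ≤ ∫ψ₀²‖∇w‖²` (Aux file) into a fraction `M ≤ 6θ` of the Dirichlet and
curvature terms. Collecting, `𝒲 ≥ κ(τr₀ + 4τ∫ψ₀²‖∇w‖²c) − ∫w² log w² cψ₀⁴ − 4`, `κ = 1 − 20θ`,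
and the RoundBound for `ψ₀` (S1 `stub_roundClauseEuclidean`, via `roundClause_profile`) applied
to `κw` at scale `κτ` gives `𝒲 ≥ log 6 − 2 + 2 log κ ≥ log 6 − 2 − 100θ`.
References: Perelman 2002, §3; Cao–Hamilton–Ilmanen 2004, Thm 3.4; Lee–Parker 1987, §3, §6;
Schoen 1984. [folklore]
-/

noncomputable section

-- the registered namespace `Summit.SmoothPoincare4.SmoothPoincare4.Theorems` repeats a component
set_option linter.dupNamespace false

open scoped Manifold ContDiff Topology RealInnerProductSpace
open Set Filter MeasureTheory

namespace Summit.SmoothPoincare4.SmoothPoincare4.Theorems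

open SphereSideClause CapClauseEuclideanSchwarzschildAux CapClauseEuclideanSchwarzschildAlg in
/-- **Stub E2 of line `green-blowup-conformal-entropy` (reshape R-c3): the perturbative cap clause
on `ℝ⁴` in the Schwarzschild gauge.** For `K, a > 0`, `b ≥ 0`, `0 < θ ≤ 1/100` with `bρ₁² ≤ θa`,
`b ≤ θK`, every scale `τ > 0` and every smooth `v` supported in `ball 0 ρ₁` with
`∫ (4πτ)⁻² v² Ψ⁴ = 1`, `Ψ = 4K(a + b‖z‖²)/((4K+b)‖z‖² + a)`:
`log 6 − 2 − 100θ ≤ ∫ [τ(12a²/(K(a+b‖z‖²)³) v² + 4Ψ⁻²‖∇v‖²) − v² log v² − 4v²] (4πτ)⁻² Ψ⁴`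
(substitution `w = u²v`, Cauchy–Schwarz, Hardy, and the RoundBound S1 for the bubble `ψ₀` at scale
`(1 − 20θ)τ`; see the module docstring). [cite: CaoHamiltonIlmanen2004, Thm 3.4] [folklore] -/
theorem stub_capClauseEuclideanSchwarzschild :
    ∀ (K a b ρ₁ θ : ℝ), 0 < K → 0 < a → 0 ≤ b → 0 < ρ₁ → 0 < θ → θ ≤ 1 / 100 →
      b * ρ₁ ^ 2 ≤ θ * a → b ≤ θ * K →
      ∀ τ : ℝ, 0 < τ → ∀ v : EuclideanSpace ℝ (Fin 4) → ℝ, ContDiff ℝ ∞ v →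
      tsupport v ⊆ Metric.ball 0 ρ₁ →
      ∫ z, (4 * Real.pi * τ) ^ (-(4 : ℝ) / 2) * (v z) ^ 2 * (4 * K * (a + b * ‖z‖ ^ 2) / ((4 * K + b) * ‖z‖ ^ 2 + a)) ^ 4 = 1 →
        Real.log 6 - 2 - 100 * θ ≤
          ∫ z, (τ * ((12 * a ^ 2 / (K * (a + b * ‖z‖ ^ 2) ^ 3)) * (v z) ^ 2
                + 4 * ((4 * K * (a + b * ‖z‖ ^ 2) / ((4 * K + b) * ‖z‖ ^ 2 + a))⁻¹ ^ 2 * ‖gradient v z‖ ^ 2))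
              - (v z) ^ 2 * Real.log ((v z) ^ 2) - 4 * (v z) ^ 2)
              * ((4 * Real.pi * τ) ^ (-(4 : ℝ) / 2) * (4 * K * (a + b * ‖z‖ ^ 2) / ((4 * K + b) * ‖z‖ ^ 2 + a)) ^ 4) := by
  intro K a b ρ₁ θ hK ha hb hρ hθ hθ1 hbρ hbK τ hτ v hv hsupp hnorm
  /- parameters -/
  have h4K : 0 < 4 * K := by positivity
  have h4Kb : 0 < 4 * K + b := by positivity
  obtain ⟨μ, hμ⟩ : ∃ μ : ℝ, μ = (4 * K + b) / (4 * K) := ⟨_, rfl⟩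
  obtain ⟨E, hE⟩ : ∃ E : ℝ, E = a / (4 * K + b) := ⟨_, rfl⟩
  obtain ⟨β, hβ⟩ : ∃ β : ℝ, β = b / a := ⟨_, rfl⟩
  obtain ⟨C, hC⟩ : ∃ C : ℝ, C = a / μ ^ 2 := ⟨_, rfl⟩
  obtain ⟨p, hp⟩ : ∃ p : ℝ, p = b * ρ₁ ^ 2 / a := ⟨_, rfl⟩
  obtain ⟨q, hq⟩ : ∃ q : ℝ, q = b / (4 * K) := ⟨_, rfl⟩
  have hμ0 : 0 < μ := by rw [hμ]; positivity
  have hE0 : 0 < E := by rw [hE]; positivity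
  have hβ0 : 0 ≤ β := by rw [hβ]; positivity
  have hC0 : 0 < C := by rw [hC]; positivity
  have hp0 : 0 ≤ p := by rw [hp]; positivity
  have hq0 : 0 ≤ q := by rw [hq]; positivity
  have hpθ : p ≤ θ := by rw [hp, div_le_iff₀ ha]; linarith
  have hqθ : q ≤ θ / 4 := by rw [hq, div_le_iff₀ h4K]; linarith
  have hμq : μ = 1 + q := by rw [hμ, hq]; field_simp
  have hμ1 : 1 ≤ μ := by rw [hμq]; linarith
  have hβρ : β * ρ₁ ^ 2 = p := by rw [hβ, hp]; field_simp
  have hkey : μ * β * (ρ₁ ^ 2 + E) = p + q + p * q := by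
    rw [hμ, hβ, hE, hp, hq]; field_simp; ring
  obtain ⟨umax, humax⟩ : ∃ umax : ℝ, umax = μ * (1 + β * ρ₁ ^ 2) := ⟨_, rfl⟩
  have humax' : umax = (1 + q) * (1 + p) := by rw [humax, hμq, ← hβρ]
  have humax0 : 0 < umax := by rw [humax]; positivity
  obtain ⟨t, ht⟩ : ∃ t : ℝ, t = 5 * θ := ⟨_, rfl⟩
  have ht0 : 0 < t := by rw [ht]; positivity
  have ht1 : t ≤ 1 := by rw [ht]; linarith
  obtain ⟨M, hM⟩ : ∃ M : ℝ, M = (1 / t - 1) * (16 * μ ^ 2 * β ^ 2 * (ρ₁ ^ 2 + E) ^ 2) := ⟨_, rfl⟩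
  have hM' : M = 16 * (1 / (5 * θ) - 1) * (p + q + p * q) ^ 2 := by
    rw [hM, ← hkey, ht]; ring
  obtain ⟨hM0, hM6⟩ : 0 ≤ M ∧ M ≤ 6 * θ := by
    rw [hM']; exact numerics_M hp0 hpθ hq0 hqθ hθ hθ1
  obtain ⟨hB1, hB2⟩ := numerics_brackets hp0 hpθ hq0 hqθ hθ1 hM6
  rw [← humax'] at hB1 hB2
  obtain ⟨κ, hκ⟩ : ∃ κ : ℝ, κ = 1 - 20 * θ := ⟨_, rfl⟩
  have hκ0 : 0 < κ := by rw [hκ]; linarith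
  have hlogκ := numerics_log hθ hθ1
  rw [← hκ] at hlogκ
  obtain ⟨r₀, hr₀⟩ : ∃ r₀ : ℝ, r₀ = 48 * E / C ^ 2 := ⟨_, rfl⟩
  have hr₀0 : 0 < r₀ := by rw [hr₀]; positivity
  obtain ⟨κ₁, hκ₁⟩ : ∃ κ₁ : ℝ, κ₁ = (umax ^ 3)⁻¹ := ⟨_, rfl⟩
  have hκ₁r₀ : κ₁ * r₀ = 12 * a ^ 2 / (K * (a + b * ρ₁ ^ 2) ^ 3) := by
    rw [hκ₁, hr₀, humax, hC, hE, hβ, hμ]; exact curv_identity hK ha hb (sq_nonneg ρ₁)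
  have he4 : 4 * E / C ^ 2 = r₀ / 12 := by rw [hr₀]; ring
  obtain ⟨c, hc⟩ : ∃ c : ℝ, c = (4 * Real.pi * τ) ^ (-(4 : ℝ) / 2) := ⟨_, rfl⟩
  have hc0 : 0 < c := by rw [hc]; exact Real.rpow_pos_of_pos (by positivity) _
  rw [← hc] at hnorm ⊢
  /- the test function `w = u² v` -/
  obtain ⟨w, hw⟩ : ∃ w : EuclideanSpace ℝ (Fin 4) → ℝ,
      w = fun z ↦ (μ * (1 + β * ‖z‖ ^ 2)) ^ 2 * v z := ⟨_, rfl⟩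
  have hw_apply : ∀ z, w z = (μ * (1 + β * ‖z‖ ^ 2)) ^ 2 * v z := fun z ↦ by rw [hw]
  have hvc : HasCompactSupport v :=
    HasCompactSupport.of_support_subset_isCompact (isCompact_closedBall 0 ρ₁)
      ((subset_tsupport v).trans (hsupp.trans Metric.ball_subset_closedBall))
  have hon : ∀ z, z ∈ tsupport v → ‖z‖ ^ 2 ≤ ρ₁ ^ 2 := fun z hz ↦ by
    have h := hsupp hz
    rw [Metric.mem_ball, dist_zero_right] at h
    exact pow_le_pow_left₀ (norm_nonneg _) h.le 2
  have hws : ContDiff ℝ ∞ w := by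
    rw [hw]
    exact ((contDiff_const.mul (contDiff_const.add
      (contDiff_const.mul (contDiff_norm_sq ℝ)))).pow 2).mul hv
  have hw1 : ContDiff ℝ 1 w := hws.of_le (by exact_mod_cast le_top)
  have hv1 : ContDiff ℝ 1 v := hv.of_le (by exact_mod_cast le_top)
  have hwc : HasCompactSupport w := by rw [hw]; exact hvc.mul_left
  have htw : tsupport w ⊆ tsupport v := by rw [hw]; exact tsupport_mul_subset_right
  have hoff : ∀ z, z ∉ tsupport v → v z = 0 ∧ gradient v z = 0 ∧ w z = 0 ∧ gradient w z = 0 :=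
    fun z hz ↦ ⟨image_eq_zero_of_notMem_tsupport hz, gradient_eq_zero_of_notMem hz,
      image_eq_zero_of_notMem_tsupport fun h ↦ hz (htw h),
      gradient_eq_zero_of_notMem fun h ↦ hz (htw h)⟩
  have hgradw : ∀ z, gradient w z = (μ * (1 + β * ‖z‖ ^ 2)) ^ 2 • gradient v z +
      (2 * (μ * (1 + β * ‖z‖ ^ 2)) * v z * (2 * μ * β)) • z := fun z ↦ by
    rw [hw]; exact (hasGradientAt_w μ β (hv1.differentiable one_ne_zero z)).gradient
  /- pointwise facts about the weights -/
  have hfac : ∀ z : EuclideanSpace ℝ (Fin 4),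
      4 * K * (a + b * ‖z‖ ^ 2) / ((4 * K + b) * ‖z‖ ^ 2 + a) =
        (μ * (1 + β * ‖z‖ ^ 2)) * (C / (‖z‖ ^ 2 + E)) := fun z ↦ by
    rw [hC, hE, hβ, hμ]; exact factorisation hK ha hb (sq_nonneg _)
  have hΨpos : ∀ z : EuclideanSpace ℝ (Fin 4),
      0 < 4 * K * (a + b * ‖z‖ ^ 2) / ((4 * K + b) * ‖z‖ ^ 2 + a) := fun z ↦ by positivity
  have hu1 : ∀ z : EuclideanSpace ℝ (Fin 4), 1 ≤ μ * (1 + β * ‖z‖ ^ 2) := fun z ↦ by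
    have h1 : (1 : ℝ) ≤ 1 + β * ‖z‖ ^ 2 := le_add_of_nonneg_right (by positivity)
    have h2 := mul_le_mul hμ1 h1 zero_le_one hμ0.le
    rwa [one_mul] at h2
  have humax_of : ∀ z : EuclideanSpace ℝ (Fin 4), ‖z‖ ^ 2 ≤ ρ₁ ^ 2 →
      μ * (1 + β * ‖z‖ ^ 2) ≤ umax := fun z hz ↦ by
    rw [humax]; gcongr
  /- continuity and integrability -/
  have hpos : ∀ z : EuclideanSpace ℝ (Fin 4), (‖z‖ ^ 2 + E) ≠ 0 := fun z ↦ by positivity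
  have hm_c : Continuous fun z : EuclideanSpace ℝ (Fin 4) ↦ ‖z‖ ^ 2 := continuous_norm.pow 2
  have hψ₀c : Continuous fun z : EuclideanSpace ℝ (Fin 4) ↦ C / (‖z‖ ^ 2 + E) :=
    continuous_const.div (hm_c.add continuous_const) hpos
  have hwcont : Continuous w := hws.continuous
  have hgwc : Continuous (gradient w) := continuous_gradient hw1
  have hgvc : Continuous (gradient v) := continuous_gradient hv1
  have hI1 : Integrable fun z ↦ (C / (‖z‖ ^ 2 + E)) ^ 4 * w z ^ 2 :=
    ((hψ₀c.pow 4).mul (hwcont.pow 2)).integrable_of_hasCompactSupport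
      (HasCompactSupport.intro hwc fun z hz ↦ by simp [image_eq_zero_of_notMem_tsupport hz])
  have hI2 : Integrable fun z ↦ (C / (‖z‖ ^ 2 + E)) ^ 2 * ‖gradient w z‖ ^ 2 :=
    ((hψ₀c.pow 2).mul ((continuous_norm.comp hgwc).pow 2)).integrable_of_hasCompactSupport
      (HasCompactSupport.intro hwc fun z hz ↦ by simp [gradient_eq_zero_of_notMem hz])
  have hI3 : Integrable fun z ↦ C ^ 2 * (‖z‖ ^ 2 - 4 * E) / (‖z‖ ^ 2 + E) ^ 4 * w z ^ 2 := by
    refine Continuous.integrable_of_hasCompactSupport ?_ ?_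
    · exact ((continuous_const.mul (hm_c.sub continuous_const)).div
        ((hm_c.add continuous_const).pow 4) fun z ↦ pow_ne_zero 4 (hpos z)).mul (hwcont.pow 2)
    · exact HasCompactSupport.intro hwc fun z hz ↦ by simp [image_eq_zero_of_notMem_tsupport hz]
  have hI4 : Integrable fun z ↦ (C / (‖z‖ ^ 2 + E)) ^ 4 * (w z ^ 2 * Real.log (w z ^ 2)) :=
    ((hψ₀c.pow 4).mul (Real.continuous_mul_log.comp (hwcont.pow 2))).integrable_of_hasCompactSupport
      (HasCompactSupport.intro hwc fun z hz ↦ by simp [image_eq_zero_of_notMem_tsupport hz])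
  have hΨc : Continuous fun z : EuclideanSpace ℝ (Fin 4) ↦
      4 * K * (a + b * ‖z‖ ^ 2) / ((4 * K + b) * ‖z‖ ^ 2 + a) :=
    (continuous_const.mul (continuous_const.add (continuous_const.mul hm_c))).div
      ((continuous_const.mul hm_c).add continuous_const) fun z ↦ by positivity
  have hrc : Continuous fun z : EuclideanSpace ℝ (Fin 4) ↦
      12 * a ^ 2 / (K * (a + b * ‖z‖ ^ 2) ^ 3) :=
    continuous_const.div (continuous_const.mul ((continuous_const.add
      (continuous_const.mul hm_c)).pow 3)) fun z ↦ by positivity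
  have hFI : Integrable fun z ↦ (τ * ((12 * a ^ 2 / (K * (a + b * ‖z‖ ^ 2) ^ 3)) * (v z) ^ 2
      + 4 * ((4 * K * (a + b * ‖z‖ ^ 2) / ((4 * K + b) * ‖z‖ ^ 2 + a))⁻¹ ^ 2 * ‖gradient v z‖ ^ 2))
      - (v z) ^ 2 * Real.log ((v z) ^ 2) - 4 * (v z) ^ 2)
      * (c * (4 * K * (a + b * ‖z‖ ^ 2) / ((4 * K + b) * ‖z‖ ^ 2 + a)) ^ 4) := by
    refine (continuous_density hrc hv.continuous ((continuous_norm.comp hgvc).pow 2) hΨc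
      (fun z ↦ (hΨpos z).ne') τ c).integrable_of_hasCompactSupport ?_
    exact HasCompactSupport.intro hvc fun z hz ↦ by
      obtain ⟨h1, h2, -, -⟩ := hoff z hz
      simp [h1, h2]
  /- the main pointwise inequality -/
  have key : ∀ z, (τ * c * (κ₁ * r₀) - 4 * τ * c * M * (4 * E / C ^ 2) - 4 * c)
        * ((C / (‖z‖ ^ 2 + E)) ^ 4 * w z ^ 2)
      + 4 * τ * c * (1 - t) * (umax ^ 2)⁻¹ * ((C / (‖z‖ ^ 2 + E)) ^ 2 * ‖gradient w z‖ ^ 2)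
      + -(4 * τ * c * M) * (C ^ 2 * (‖z‖ ^ 2 - 4 * E) / (‖z‖ ^ 2 + E) ^ 4 * w z ^ 2)
      - c * ((C / (‖z‖ ^ 2 + E)) ^ 4 * (w z ^ 2 * Real.log (w z ^ 2))) ≤
      (τ * ((12 * a ^ 2 / (K * (a + b * ‖z‖ ^ 2) ^ 3)) * (v z) ^ 2
        + 4 * ((4 * K * (a + b * ‖z‖ ^ 2) / ((4 * K + b) * ‖z‖ ^ 2 + a))⁻¹ ^ 2
          * ‖gradient v z‖ ^ 2))
        - (v z) ^ 2 * Real.log ((v z) ^ 2) - 4 * (v z) ^ 2)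
        * (c * (4 * K * (a + b * ‖z‖ ^ 2) / ((4 * K + b) * ‖z‖ ^ 2 + a)) ^ 4) := by
    intro z
    by_cases hz : z ∈ tsupport v
    · have hm := hon z hz
      have hU1 := hu1 z
      have hUmax := humax_of z hm
      have hR := curv_compare hK ha hb (sq_nonneg ‖z‖) hm
      rw [← hκ₁r₀] at hR
      have hP0 : 0 < C / (‖z‖ ^ 2 + E) := by positivity
      have hgrad := grad_estimate (C := C) (gradient v z) (gradient w z) z hU1 hUmax hE0 hm ht0
        ht1 (hgradw z)
      rw [← hM] at hgrad
      rw [hfac z, hw_apply z]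
      refine combine hτ.le hc0.le ?_ (hgrad.trans_eq ?_) (log_estimate (v z) _ _ hU1) (by ring) ?_
      · calc κ₁ * r₀ * ((C / (‖z‖ ^ 2 + E)) ^ 4 * ((μ * (1 + β * ‖z‖ ^ 2)) ^ 2 * v z) ^ 2)
            ≤ 12 * a ^ 2 / (K * (a + b * ‖z‖ ^ 2) ^ 3) *
              ((C / (‖z‖ ^ 2 + E)) ^ 4 * ((μ * (1 + β * ‖z‖ ^ 2)) ^ 2 * v z) ^ 2) :=
              mul_le_mul_of_nonneg_right hR (by positivity)
          _ = _ := by ring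
      · have hUP : μ * (1 + β * ‖z‖ ^ 2) * (C / (‖z‖ ^ 2 + E)) ≠ 0 := by positivity
        field_simp
      · field_simp
        ring
    · obtain ⟨h1, h2, h3, h4⟩ := hoff z hz
      simp [h1, h2, h3, h4]
  /- integrate the pointwise inequality -/
  have hGI : Integrable fun z ↦ (τ * c * (κ₁ * r₀) - 4 * τ * c * M * (4 * E / C ^ 2) - 4 * c)
        * ((C / (‖z‖ ^ 2 + E)) ^ 4 * w z ^ 2)
      + 4 * τ * c * (1 - t) * (umax ^ 2)⁻¹ * ((C / (‖z‖ ^ 2 + E)) ^ 2 * ‖gradient w z‖ ^ 2)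
      + -(4 * τ * c * M) * (C ^ 2 * (‖z‖ ^ 2 - 4 * E) / (‖z‖ ^ 2 + E) ^ 4 * w z ^ 2)
      - c * ((C / (‖z‖ ^ 2 + E)) ^ 4 * (w z ^ 2 * Real.log (w z ^ 2))) :=
    (((hI1.const_mul _).fun_add (hI2.const_mul _)).fun_add (hI3.const_mul _)).sub' (hI4.const_mul _)
  have hmono := integral_mono hGI hFI key
  rw [integral_sub (((hI1.const_mul _).fun_add (hI2.const_mul _)).fun_add (hI3.const_mul _))
    (hI4.const_mul _), integral_add ((hI1.const_mul _).fun_add (hI2.const_mul _))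
    (hI3.const_mul _), integral_add (hI1.const_mul _) (hI2.const_mul _), integral_const_mul,
    integral_const_mul, integral_const_mul, integral_const_mul] at hmono
  /- Hardy -/
  have hHardy := hardy (C := C) hE0 hws hwc
  /- normalisation -/
  have hnorm1 : c * ∫ z, (C / (‖z‖ ^ 2 + E)) ^ 4 * w z ^ 2 = 1 := by
    rw [← integral_const_mul, ← hnorm]
    refine integral_congr_ae (Eventually.of_forall fun z ↦ ?_)
    simp only
    rw [hfac z, hw_apply z]
    ring
  /- the round clause for `κ w` at scale `κ τ` -/
  have hwκs : ContDiff ℝ ∞ (fun z ↦ κ * w z) := contDiff_const.mul hws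
  have hwκc : HasCompactSupport (fun z ↦ κ * w z) := hwc.mul_left
  have hscale := rpow_scale hκ0 hτ
  rw [← hc] at hscale
  have hnormκ : ∫ y, (4 * Real.pi * (κ * τ)) ^ (-(4 : ℝ) / 2) * (κ * w y) ^ 2 *
      (C / (‖y‖ ^ 2 + E)) ^ 4 = 1 := by
    rw [← hnorm1, ← integral_const_mul]
    refine integral_congr_ae (Eventually.of_forall fun y ↦ ?_)
    rw [hscale]
    field_simp
  have hR0 := roundClause_profile hC0 hE0 (by positivity : 0 < κ * τ) hwκs hwκc hnormκ
  have hlog2 : ∀ y, (κ * w y) ^ 2 * Real.log ((κ * w y) ^ 2) =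
      κ ^ 2 * (2 * Real.log κ * w y ^ 2 + w y ^ 2 * Real.log (w y ^ 2)) := by
    intro y
    by_cases hwy : w y = 0
    · rw [hwy]; simp
    · rw [mul_pow, Real.log_mul (pow_ne_zero 2 hκ0.ne') (pow_ne_zero 2 hwy), Real.log_pow]
      push_cast
      ring
  have hR0pt : ∀ y, (κ * τ * (48 * E / C ^ 2 * (κ * w y) ^ 2 +
      4 * ((C / (‖y‖ ^ 2 + E))⁻¹ ^ 2 * ‖gradient (fun y ↦ κ * w y) y‖ ^ 2))
      - (κ * w y) ^ 2 * Real.log ((κ * w y) ^ 2) - 4 * (κ * w y) ^ 2)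
      * ((4 * Real.pi * (κ * τ)) ^ (-(4 : ℝ) / 2) * (C / (‖y‖ ^ 2 + E)) ^ 4) =
      (c * (κ * τ * r₀) - c * (2 * Real.log κ) - 4 * c) * ((C / (‖y‖ ^ 2 + E)) ^ 4 * w y ^ 2)
      + 4 * κ * τ * c * ((C / (‖y‖ ^ 2 + E)) ^ 2 * ‖gradient w y‖ ^ 2)
      - c * ((C / (‖y‖ ^ 2 + E)) ^ 4 * (w y ^ 2 * Real.log (w y ^ 2))) := by
    intro y
    rw [hscale, gradient_const_mul (hw1.differentiable one_ne_zero y) κ, norm_smul,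
      Real.norm_eq_abs, abs_of_pos hκ0, hlog2 y, hr₀]
    have hP : C / (‖y‖ ^ 2 + E) ≠ 0 := by positivity
    field_simp
    ring
  have hR0I : Integrable fun y ↦
      (c * (κ * τ * r₀) - c * (2 * Real.log κ) - 4 * c) * ((C / (‖y‖ ^ 2 + E)) ^ 4 * w y ^ 2)
      + 4 * κ * τ * c * ((C / (‖y‖ ^ 2 + E)) ^ 2 * ‖gradient w y‖ ^ 2) :=
    (hI1.const_mul _).fun_add (hI2.const_mul _)
  rw [integral_congr_ae (Eventually.of_forall hR0pt), integral_sub hR0I (hI4.const_mul _),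
    integral_add (hI1.const_mul _) (hI2.const_mul _), integral_const_mul, integral_const_mul,
    integral_const_mul] at hR0
  /- the final arithmetic -/
  have hD0 : 0 ≤ ∫ z, (C / (‖z‖ ^ 2 + E)) ^ 2 * ‖gradient w z‖ ^ 2 :=
    integral_nonneg fun z ↦ by positivity
  generalize ∫ z, (C / (‖z‖ ^ 2 + E)) ^ 4 * w z ^ 2 = I₁ at *
  generalize ∫ z, (C / (‖z‖ ^ 2 + E)) ^ 2 * ‖gradient w z‖ ^ 2 = D at *
  generalize ∫ z, C ^ 2 * (‖z‖ ^ 2 - 4 * E) / (‖z‖ ^ 2 + E) ^ 4 * w z ^ 2 = H at *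
  generalize ∫ z, (C / (‖z‖ ^ 2 + E)) ^ 4 * (w z ^ 2 * Real.log (w z ^ 2)) = L at *
  have eG : (τ * c * (κ₁ * r₀) - 4 * τ * c * M * (4 * E / C ^ 2) - 4 * c) * I₁
      + 4 * τ * c * (1 - t) * (umax ^ 2)⁻¹ * D + -(4 * τ * c * M) * H - c * L
      = (τ * (κ₁ * r₀) - τ * M * r₀ / 3 - 4) * (c * I₁)
        + 4 * τ * ((1 - t) * (umax ^ 2)⁻¹) * (c * D) - 4 * τ * M * (c * H) - c * L := by
    rw [he4]; ring
  have eR : (c * (κ * τ * r₀) - c * (2 * Real.log κ) - 4 * c) * I₁ + 4 * κ * τ * c * D - c * L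
      = (κ * (τ * r₀) - 2 * Real.log κ - 4) * (c * I₁) + κ * (4 * τ * (c * D)) - c * L := by
    ring
  rw [eG, hnorm1] at hmono
  rw [eR, hnorm1] at hR0
  have hcD0 : 0 ≤ c * D := by positivity
  have hcH : c * H ≤ c * D := mul_le_mul_of_nonneg_left hHardy hc0.le
  have f5 : κ * (τ * r₀) ≤ (κ₁ - M / 3) * (τ * r₀) :=
    mul_le_mul_of_nonneg_right (by rw [hκ, hκ₁]; exact hB1) (by positivity)
  have f6 : κ * (4 * τ * (c * D)) ≤ ((1 - t) * (umax ^ 2)⁻¹ - M) * (4 * τ * (c * D)) :=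
    mul_le_mul_of_nonneg_right (by rw [hκ, ht]; exact hB2) (by positivity)
  have f7 : 4 * τ * M * (c * H) ≤ 4 * τ * M * (c * D) :=
    mul_le_mul_of_nonneg_left hcH (by positivity)
  linarith

end Summit.SmoothPoincare4.SmoothPoincare4.Theorems

end
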